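import Mathlib

/-!
# Negative-squares rungs at `m ≤ 2` — PORT TURNKEY (sorry-free, imports Mathlib only)

Source: `Cruxes/MatrixDescartes/Lines/negsquares.lean` (val-idea-6 g5, v2.2 @a849dec27b5b), the stub-free
part suggested for porting by val-idea-crit-1 VERDICT #41 (A).  Contents (all PROVED):

* `card_posRoots_le_two_mul_negCoeffCount` — DOUBLED DESCARTES: a real polynomial has at most
  `2 · #{negative coefficients}` distinct positive zeros (via Mathlib's rule of signs); `_neg` variant.
* `scalar_rung` — `m = 1`: `Σ (p_l − n_l) X^{d_l}` with `p_l ≥ 0` has `≤ 2 · #{l : n_l ≠ 0}` positive zeros.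
* `rankOne_two_le` — `m = 2`, one negative square: PSD `2×2` letters `P l` at exponents `d l` minus
  `X^e · wwᵀ` ⇒ `Z₊ ≤ 2K`; `door26_rankOne_sector`: `≤ 12` on the `(2,6)` door.
* `semidefinite_pair_two_le` — `m = 2`, semidefinite words: PSD letters (support `I`) against NSD letters
  (support `J`), any exponents ⇒ `Z₊ ≤ 2|I||J|`; `door26_semidefinite_sector`: six semidefinite `2×2`
  letters ⇒ `Z₊ ≤ 18` (`≤ 19 = DoorA26`'s bound, stmt-ValiantsHypothesis-19979, same pencil expression as
  `PosRootLawAt 2 6 ·`).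

Suggested target: `Theorems/LacunarySymmetroidMatrixDescartesNegSquaresRungs.lean`, `--supports
stmt-ValiantsHypothesis-18050` (helpers by name for the door cells on 19979 and the Lift rank-one sector).
HONEST FRAME: sector theorems at `m ≤ 2`; `MatrixDescartes`, `DoorA26`, B and VP ≠ VNP untouched.
-/

open Polynomial Finset

set_option linter.dupNamespace false

namespace Summit.ValiantsHypothesis.ValiantsHypothesis.Theorems.LacunarySymmetroidMatrixDescartes.NegSquaresRungs

/-- The number of negative coefficients of a real polynomial. -/
noncomputable def negCoeffCount (P : ℝ[X]) : ℕ := (P.support.filter (fun n => P.coeff n < 0)).card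

theorem negCoeffCount_eq_eraseLead_add {P : ℝ[X]} (hP : P ≠ 0) :
    negCoeffCount P = negCoeffCount P.eraseLead + (if P.leadingCoeff < 0 then 1 else 0) := by
  unfold negCoeffCount
  have hmem : P.natDegree ∈ P.support := Polynomial.natDegree_mem_support_of_nonzero hP
  have hnot : P.natDegree ∉ P.eraseLead.support := by
    rw [Polynomial.eraseLead_support]
    exact Finset.notMem_erase _ _
  have hsupp : P.support = insert P.natDegree P.eraseLead.support := by
    rw [Polynomial.eraseLead_support, Finset.insert_erase hmem]
  have hcongr : P.eraseLead.support.filter (fun n => P.coeff n < 0)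
      = P.eraseLead.support.filter (fun n => P.eraseLead.coeff n < 0) := by
    apply Finset.filter_congr
    intro n hn
    have hne : n ≠ P.natDegree := fun h => hnot (h ▸ hn)
    rw [Polynomial.eraseLead_coeff_of_ne _ hne]
  rw [hsupp, Finset.filter_insert]
  by_cases h : P.coeff P.natDegree < 0
  · have h' : P.leadingCoeff < 0 := h
    rw [if_pos h, if_pos h', Finset.card_insert_of_notMem (fun hx => hnot (Finset.mem_filter.mp hx).1),
      hcongr]
  · have h' : ¬ P.leadingCoeff < 0 := h
    rw [if_neg h, if_neg h', hcongr, add_zero]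

/-- **Doubled Descartes, inductive form**: `signVariations P + [leadingCoeff P < 0] ≤ 2 · negCoeffCount P`. -/
theorem signVariations_add_ite_le (P : ℝ[X]) :
    P.signVariations + (if P.leadingCoeff < 0 then 1 else 0) ≤ 2 * negCoeffCount P := by
  induction hn : P.support.card using Nat.strong_induction_on generalizing P with
  | _ n ih =>
    rcases eq_or_ne P 0 with rfl | hP
    · simp [negCoeffCount]
    have hlt : P.eraseLead.support.card < n := hn ▸ Polynomial.eraseLead_support_card_lt hP
    have ihQ := ih _ hlt P.eraseLead rfl
    rw [Polynomial.signVariations_eq_eraseLead_add_ite hP, negCoeffCount_eq_eraseLead_add hP]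
    have hlc : P.leadingCoeff ≠ 0 := Polynomial.leadingCoeff_ne_zero.mpr hP
    have h1 : (if SignType.sign P.leadingCoeff = -SignType.sign P.eraseLead.leadingCoeff then 1 else 0)
        ≤ 1 := by
      split_ifs <;> omega
    by_cases hneg : P.leadingCoeff < 0
    · rw [if_pos hneg]
      have h2 : P.eraseLead.signVariations ≤ 2 * negCoeffCount P.eraseLead :=
        le_trans (Nat.le_add_right _ _) ihQ
      omega
    · have hpos : 0 < P.leadingCoeff := lt_of_le_of_ne (not_lt.mp hneg) hlc.symm
      rw [if_neg hneg]
      by_cases hι : SignType.sign P.leadingCoeff = -SignType.sign P.eraseLead.leadingCoeff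
      · have hQneg : P.eraseLead.leadingCoeff < 0 := by
          rw [sign_pos hpos] at hι
          exact sign_eq_neg_one_iff.mp (neg_eq_iff_eq_neg.mp hι.symm)
        rw [if_pos hι]
        rw [if_pos hQneg] at ihQ
        omega
      · rw [if_neg hι]
        have h2 : P.eraseLead.signVariations ≤ 2 * negCoeffCount P.eraseLead :=
          le_trans (Nat.le_add_right _ _) ihQ
        omega

/-- **Doubled Descartes**: distinct positive zeros `≤ 2 · #negative coefficients`. -/
theorem card_posRoots_le_two_mul_negCoeffCount (P : ℝ[X]) :
    (P.roots.toFinset.filter (fun t => 0 < t)).card ≤ 2 * negCoeffCount P := by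
  calc (P.roots.toFinset.filter (fun t => 0 < t)).card
      = ((P.roots.filter (fun t => 0 < t)).toFinset).card := by rw [Multiset.toFinset_filter]
    _ ≤ Multiset.card (P.roots.filter (fun t => 0 < t)) := Multiset.toFinset_card_le _
    _ = P.roots.countP (fun t => 0 < t) := (Multiset.countP_eq_card_filter _ _).symm
    _ ≤ P.signVariations := P.roots_countP_pos_le_signVariations
    _ ≤ 2 * negCoeffCount P := le_trans (Nat.le_add_right _ _) (signVariations_add_ite_le P)

/-- By symmetry (`roots (−P) = roots P`): distinct positive zeros `≤ 2 · #positive coefficients` too. -/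
theorem card_posRoots_le_two_mul_negCoeffCount_neg (P : ℝ[X]) :
    (P.roots.toFinset.filter (fun t => 0 < t)).card ≤ 2 * negCoeffCount (-P) := by
  simpa [Polynomial.roots_neg] using card_posRoots_le_two_mul_negCoeffCount (-P)

/-- **`m = 1` rung (PROVED).** -/
theorem scalar_rung {K : ℕ} (d : Fin K → ℕ) (p n : Fin K → ℝ) (hp : ∀ l, 0 ≤ p l) :
    ((∑ l, C (p l - n l) * (X : ℝ[X]) ^ d l).roots.toFinset.filter (fun t => 0 < t)).card
      ≤ 2 * (Finset.univ.filter (fun l => n l ≠ 0)).card := by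
  refine (card_posRoots_le_two_mul_negCoeffCount _).trans (Nat.mul_le_mul_left 2 ?_)
  unfold negCoeffCount
  -- every exponent with a negative coefficient is some `d l` with `n l ≠ 0`
  have hsub : (∑ l, C (p l - n l) * (X : ℝ[X]) ^ d l).support.filter
        (fun j => (∑ l, C (p l - n l) * (X : ℝ[X]) ^ d l).coeff j < 0)
      ⊆ (Finset.univ.filter (fun l => n l ≠ 0)).image d := by
    intro j hj
    rw [Finset.mem_filter] at hj
    have hc : (∑ l, C (p l - n l) * (X : ℝ[X]) ^ d l).coeff j
        = ∑ l, (if j = d l then p l - n l else 0) := by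
      rw [Polynomial.finsetSum_coeff]
      refine Finset.sum_congr rfl (fun l _ => ?_)
      rw [Polynomial.coeff_C_mul_X_pow]
    have hlt : ∑ l, (if j = d l then p l - n l else 0) < ∑ _l : Fin K, (0 : ℝ) := by
      rw [← hc]; simpa using hj.2
    obtain ⟨l, -, hl⟩ := Finset.exists_lt_of_sum_lt hlt
    rw [Finset.mem_image]
    by_cases hjl : j = d l
    · rw [if_pos hjl] at hl
      refine ⟨l, Finset.mem_filter.mpr ⟨Finset.mem_univ _, ?_⟩, hjl.symm⟩
      intro h0
      have := hp l
      rw [h0] at hl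
      linarith
    · rw [if_neg hjl] at hl
      exact absurd hl (lt_irrefl 0)
  exact (Finset.card_le_card hsub).trans Finset.card_image_le

theorem two_mul_le_of_psd2 (a b c a' b' c' : ℝ) (ha : 0 ≤ a) (hc : 0 ≤ c) (ha' : 0 ≤ a') (hc' : 0 ≤ c')
    (h1 : b ^ 2 ≤ a * c) (h2 : b' ^ 2 ≤ a' * c') : 2 * (b * b') ≤ a * c' + a' * c := by
  have hbb : (b * b') ^ 2 ≤ (a * c) * (a' * c') := by
    rw [mul_pow]; exact mul_le_mul h1 h2 (sq_nonneg _) (mul_nonneg ha hc)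
  have key : 4 * (b * b') ^ 2 ≤ (a * c' + a' * c) ^ 2 := by nlinarith [sq_nonneg (a * c' - a' * c)]
  have hX : 0 ≤ a * c' + a' * c := by positivity
  nlinarith [key, hX, sq_nonneg (a * c' + a' * c - 2 * (b * b'))]

theorem entry_eq {K : ℕ} (d : Fin K → ℕ) (e : ℕ) (w : Fin 2 → ℝ) (P : Fin K → Matrix (Fin 2) (Fin 2) ℝ)
    (i j : Fin 2) :
    (((X : ℝ[X]) ^ e) • (-Matrix.vecMulVec w w).map C + ∑ l, (X : ℝ[X]) ^ d l • (P l).map C) i j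
      = -(C (w i * w j) * X ^ e) + ∑ l, C (P l i j) * X ^ d l := by
  simp only [Matrix.add_apply, Matrix.smul_apply, Matrix.map_apply, Matrix.neg_apply,
    Matrix.vecMulVec_apply, Matrix.sum_apply, smul_eq_mul, map_neg]
  congr 1
  · ring
  · exact Finset.sum_congr rfl (fun l _ => by ring)

/-- Coefficients of a product of two lacunary sums on the same exponents. -/
theorem coeff_sum_mul_sum {K : ℕ} (d : Fin K → ℕ) (x y : Fin K → ℝ) (n : ℕ) :
    ((∑ l, C (x l) * (X : ℝ[X]) ^ d l) * (∑ l, C (y l) * (X : ℝ[X]) ^ d l)).coeff n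
      = ∑ l, ∑ l', (if n = d l + d l' then x l * y l' else 0) := by
  rw [Finset.sum_mul_sum, finsetSum_coeff]
  refine Finset.sum_congr rfl (fun l _ => ?_)
  rw [finsetSum_coeff]
  refine Finset.sum_congr rfl (fun l' _ => ?_)
  have : C (x l) * (X : ℝ[X]) ^ d l * (C (y l') * X ^ d l') = C (x l * y l') * X ^ (d l + d l') := by
    rw [C_mul, pow_add]; ring
  rw [this, coeff_C_mul_X_pow]

/-- Coefficients of a lacunary sum vanish off the exponent set. -/
theorem coeff_sum_eq_zero {K : ℕ} (d : Fin K → ℕ) (x : Fin K → ℝ) (k : ℕ) (hk : ∀ l, k ≠ d l) :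
    (∑ l, C (x l) * (X : ℝ[X]) ^ d l).coeff k = 0 := by
  rw [finsetSum_coeff]
  refine Finset.sum_eq_zero (fun l _ => ?_)
  rw [coeff_C_mul_X_pow, if_neg (hk l)]

/-- The symmetrised AM-GM step: the `X^n` coefficient of `A·C − B²` is nonnegative. -/
theorem double_sum_nonneg {K : ℕ} (d : Fin K → ℕ) (a b c : Fin K → ℝ)
    (ha : ∀ l, 0 ≤ a l) (hc : ∀ l, 0 ≤ c l) (hb : ∀ l, b l ^ 2 ≤ a l * c l) (n : ℕ) :
    0 ≤ (∑ l, ∑ l', (if n = d l + d l' then a l * c l' else 0))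
        - ∑ l, ∑ l', (if n = d l + d l' then b l * b l' else 0) := by
  set T : Fin K → Fin K → ℝ := fun l l' => if n = d l + d l' then a l * c l' - b l * b l' else 0 with hT
  have hS : (∑ l, ∑ l', (if n = d l + d l' then a l * c l' else 0))
        - ∑ l, ∑ l', (if n = d l + d l' then b l * b l' else 0) = ∑ l, ∑ l', T l l' := by
    rw [← Finset.sum_sub_distrib]
    refine Finset.sum_congr rfl (fun l _ => ?_)
    rw [← Finset.sum_sub_distrib]
    refine Finset.sum_congr rfl (fun l' _ => ?_)
    simp only [hT]; split_ifs <;> simp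
  rw [hS]
  have hcomm : ∑ l, ∑ l', T l l' = ∑ l, ∑ l', T l' l := Finset.sum_comm
  have h2 : 2 * ∑ l, ∑ l', T l l' = ∑ l, ∑ l', (T l l' + T l' l) := by
    rw [two_mul]
    conv_lhs => rw [show (∑ l, ∑ l', T l l') + ∑ l, ∑ l', T l l'
      = (∑ l, ∑ l', T l l') + ∑ l, ∑ l', T l' l from by rw [← hcomm]]
    rw [← Finset.sum_add_distrib]
    refine Finset.sum_congr rfl (fun l _ => ?_)
    rw [← Finset.sum_add_distrib]
  have hpos : 0 ≤ ∑ l, ∑ l', (T l l' + T l' l) := by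
    refine Finset.sum_nonneg (fun l _ => Finset.sum_nonneg (fun l' _ => ?_))
    simp only [hT]
    by_cases h : n = d l + d l'
    · have h' : n = d l' + d l := by rw [add_comm]; exact h
      rw [if_pos h, if_pos h']
      nlinarith [two_mul_le_of_psd2 (a l) (b l) (c l) (a l') (b l') (c l') (ha l) (hc l) (ha l') (hc l')
        (hb l) (hb l')]
    · have h' : ¬ n = d l' + d l := by rwa [add_comm]
      rw [if_neg h, if_neg h']; simp
  linarith

/-- **κ = 1 at m = 2 (kernel).**  For PSD `2×2` letters `P l` and one subtracted rank-one letter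
`X^e · wwᵀ`, every coefficient of `det` off the exponents `e + d l` is nonnegative. -/
theorem coeff_nonneg_off {K : ℕ} (d : Fin K → ℕ) (e : ℕ) (w : Fin 2 → ℝ)
    (P : Fin K → Matrix (Fin 2) (Fin 2) ℝ) (hP : ∀ l, (P l).PosSemidef) (n : ℕ)
    (hn : ∀ l, n ≠ e + d l) :
    0 ≤ (Matrix.det (((X : ℝ[X]) ^ e) • (-Matrix.vecMulVec w w).map C
        + ∑ l, (X : ℝ[X]) ^ d l • (P l).map C)).coeff n := by
  -- letters' entries
  have hsym : ∀ l, P l 1 0 = P l 0 1 := fun l => by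
    have := (hP l).isHermitian.apply 0 1
    simpa using this
  have ha : ∀ l, 0 ≤ P l 0 0 := fun l => (hP l).diag_nonneg
  have hc : ∀ l, 0 ≤ P l 1 1 := fun l => (hP l).diag_nonneg
  have hb : ∀ l, P l 0 1 ^ 2 ≤ P l 0 0 * P l 1 1 := fun l => by
    have h := (hP l).det_nonneg
    rw [Matrix.det_fin_two, hsym l] at h
    nlinarith [h]
  -- the determinant identity  det = (A·Cc − B·B) − X^e · q
  set A : ℝ[X] := ∑ l, C (P l 0 0) * X ^ d l with hA
  set B : ℝ[X] := ∑ l, C (P l 0 1) * X ^ d l with hB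
  set Cc : ℝ[X] := ∑ l, C (P l 1 1) * X ^ d l with hCc
  set q : ℝ[X] := C (w 1 * w 1) * A + C (w 0 * w 0) * Cc - C (2 * (w 0 * w 1)) * B with hq
  have hB' : ∑ l, C (P l 1 0) * (X : ℝ[X]) ^ d l = B := by
    simp only [hB, hsym]
  have hdet : Matrix.det (((X : ℝ[X]) ^ e) • (-Matrix.vecMulVec w w).map C
        + ∑ l, (X : ℝ[X]) ^ d l • (P l).map C) = (A * Cc - B * B) - X ^ e * q := by
    rw [Matrix.det_fin_two, entry_eq, entry_eq, entry_eq, entry_eq, hB', ← hA, ← hB, ← hCc]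
    have hCC : C (w 0 * w 0) * C (w 1 * w 1) = C (w 0 * w 1) * C (w 1 * w 0) := by
      rw [← C_mul, ← C_mul]; congr 1; ring
    have hβ : (C (w 1 * w 0) : ℝ[X]) = C (w 0 * w 1) := by rw [mul_comm]
    rw [hβ] at hCC ⊢
    have hC2 : (C (2 * (w 0 * w 1)) : ℝ[X]) = 2 * C (w 0 * w 1) := by
      rw [C_mul, map_ofNat]
    rw [hq, hC2]
    linear_combination (X ^ e) ^ 2 * hCC
  rw [hdet, coeff_sub]
  -- the subtracted part lives on the exponents `e + d l`
  have hq0 : (X ^ e * q).coeff n = 0 := by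
    rw [coeff_X_pow_mul']
    split_ifs with he
    · have hk : ∀ l, n - e ≠ d l := fun l h => hn l (by omega)
      have hA0 : A.coeff (n - e) = 0 := coeff_sum_eq_zero d _ (n - e) hk
      have hB0 : B.coeff (n - e) = 0 := coeff_sum_eq_zero d _ (n - e) hk
      have hC0 : Cc.coeff (n - e) = 0 := coeff_sum_eq_zero d _ (n - e) hk
      simp only [hq, coeff_sub, coeff_add, coeff_C_mul, hA0, hB0, hC0, mul_zero, add_zero, sub_zero]
    · rfl
  rw [hq0, sub_zero, coeff_sub, hA, hB, hCc, coeff_sum_mul_sum, coeff_sum_mul_sum]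
  exact double_sum_nonneg d _ _ _ ha hc hb n

/-- **`κ = 1`, `m = 2`: `Z₊ ≤ 2K` (PROVED).**  The two-sided rank-one sector at size 2 obeys the doubled
fewnomial count in the number of PSD letters — uniformly in the exponents `d`, `e` and all heights. -/
theorem rankOne_two_le {K : ℕ} (d : Fin K → ℕ) (e : ℕ) (w : Fin 2 → ℝ)
    (P : Fin K → Matrix (Fin 2) (Fin 2) ℝ) (hP : ∀ l, (P l).PosSemidef) :
    ((Matrix.det (((X : ℝ[X]) ^ e) • (-Matrix.vecMulVec w w).map C
        + ∑ l, (X : ℝ[X]) ^ d l • (P l).map C)).roots.toFinset.filter (fun t => 0 < t)).card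
      ≤ 2 * K := by
  set f := Matrix.det (((X : ℝ[X]) ^ e) • (-Matrix.vecMulVec w w).map C
        + ∑ l, (X : ℝ[X]) ^ d l • (P l).map C) with hf
  refine (card_posRoots_le_two_mul_negCoeffCount f).trans ?_
  refine Nat.mul_le_mul_left 2 ?_
  -- negative coefficients only at the exponents `e + d l`
  have hsub : f.support.filter (fun n => f.coeff n < 0)
      ⊆ Finset.univ.image (fun l : Fin K => e + d l) := by
    intro n hn
    rw [Finset.mem_filter] at hn
    by_contra hno
    have hne : ∀ l, n ≠ e + d l := fun l h =>
      hno (Finset.mem_image.mpr ⟨l, Finset.mem_univ _, h.symm⟩)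
    exact absurd (coeff_nonneg_off d e w P hP n hne) (not_le.mpr hn.2)
  calc negCoeffCount f ≤ (Finset.univ.image (fun l : Fin K => e + d l)).card :=
        Finset.card_le_card hsub
    _ ≤ (Finset.univ : Finset (Fin K)).card := Finset.card_image_le
    _ = K := by simp

/-- The `(2,6)` door's `κ ≤ 1` sector (stmt-ValiantsHypothesis-19979 `DoorA26 = PosRootLawAt 2 6 19`):
six PSD `2×2` letters and one subtracted rank-one square at any exponent `e` (equal to some `d l` or
not) give at most `12 ≤ 19` positive zeros.  So every `DoorA26` violator has `κ ≥ 2`. -/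
theorem door26_rankOne_sector (d : Fin 6 → ℕ) (e : ℕ) (w : Fin 2 → ℝ)
    (P : Fin 6 → Matrix (Fin 2) (Fin 2) ℝ) (hP : ∀ l, (P l).PosSemidef) :
    ((Matrix.det (((X : ℝ[X]) ^ e) • (-Matrix.vecMulVec w w).map C
        + ∑ l, (X : ℝ[X]) ^ d l • (P l).map C)).roots.toFinset.filter (fun t => 0 < t)).card
      ≤ 12 :=
  (rankOne_two_le d e w P hP).trans (by norm_num)

theorem coeff_sum_mul_sum₂ {K : ℕ} (d e : Fin K → ℕ) (x y : Fin K → ℝ) (n : ℕ) :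
    ((∑ l, C (x l) * (X : ℝ[X]) ^ d l) * (∑ l, C (y l) * (X : ℝ[X]) ^ e l)).coeff n
      = ∑ l, ∑ l', (if n = d l + e l' then x l * y l' else 0) := by
  rw [Finset.sum_mul_sum, finsetSum_coeff]
  refine Finset.sum_congr rfl (fun l _ => ?_)
  rw [finsetSum_coeff]
  refine Finset.sum_congr rfl (fun l' _ => ?_)
  have : C (x l) * (X : ℝ[X]) ^ d l * (C (y l') * X ^ e l') = C (x l * y l') * X ^ (d l + e l') := by
    rw [C_mul, pow_add]; ring
  rw [this, coeff_C_mul_X_pow]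

/-- entries of a PSD-minus-PSD two-family pencil at `m = 2` -/
theorem entry_eq₂ {K : ℕ} (d e : Fin K → ℕ) (P N : Fin K → Matrix (Fin 2) (Fin 2) ℝ) (i j : Fin 2) :
    ((∑ l, (X : ℝ[X]) ^ d l • (P l).map C) - ∑ l, (X : ℝ[X]) ^ e l • (N l).map C) i j
      = (∑ l, C (P l i j) * X ^ d l) - ∑ l, C (N l i j) * X ^ e l := by
  simp only [Matrix.sub_apply, Matrix.smul_apply, Matrix.map_apply, Matrix.sum_apply, smul_eq_mul]
  congr 1 <;> exact Finset.sum_congr rfl (fun l _ => by ring)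

/-- PSD data of a `2×2` real PSD matrix. -/
theorem psd2_data (M : Matrix (Fin 2) (Fin 2) ℝ) (hM : M.PosSemidef) :
    M 1 0 = M 0 1 ∧ 0 ≤ M 0 0 ∧ 0 ≤ M 1 1 ∧ M 0 1 ^ 2 ≤ M 0 0 * M 1 1 := by
  have hsym : M 1 0 = M 0 1 := by simpa using hM.isHermitian.apply 0 1
  refine ⟨hsym, hM.diag_nonneg, hM.diag_nonneg, ?_⟩
  have h := hM.det_nonneg
  rw [Matrix.det_fin_two, hsym] at h
  nlinarith [h]

/-- **Semidefinite two-family pencils at `m = 2`.**  PSD letters `P l` at exponents `d l` and NSD letters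
`−N l` at exponents `e l`, with `P` supported on `I` and `N` on `J`: every coefficient of `det` off the
sumset `d(I) + e(J)` is nonnegative. -/
theorem coeff_nonneg_off₂ {K : ℕ} (d e : Fin K → ℕ) (P N : Fin K → Matrix (Fin 2) (Fin 2) ℝ)
    (hP : ∀ l, (P l).PosSemidef) (hN : ∀ l, (N l).PosSemidef) (I J : Finset (Fin K))
    (hI : ∀ l, l ∉ I → P l = 0) (hJ : ∀ l, l ∉ J → N l = 0) (n : ℕ)
    (hn : n ∉ Finset.image₂ (fun l l' => d l + e l') I J) :
    0 ≤ (Matrix.det ((∑ l, (X : ℝ[X]) ^ d l • (P l).map C)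
          - ∑ l, (X : ℝ[X]) ^ e l • (N l).map C)).coeff n := by
  set AP : ℝ[X] := ∑ l, C (P l 0 0) * X ^ d l with hAP
  set BP : ℝ[X] := ∑ l, C (P l 0 1) * X ^ d l with hBP
  set CP : ℝ[X] := ∑ l, C (P l 1 1) * X ^ d l with hCP
  set AN : ℝ[X] := ∑ l, C (N l 0 0) * X ^ e l with hAN
  set BN : ℝ[X] := ∑ l, C (N l 0 1) * X ^ e l with hBN
  set CN : ℝ[X] := ∑ l, C (N l 1 1) * X ^ e l with hCN
  have hsP : ∀ l, P l 1 0 = P l 0 1 := fun l => (psd2_data _ (hP l)).1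
  have hsN : ∀ l, N l 1 0 = N l 0 1 := fun l => (psd2_data _ (hN l)).1
  have hBP' : ∑ l, C (P l 1 0) * (X : ℝ[X]) ^ d l = BP := by simp only [hBP, hsP]
  have hBN' : ∑ l, C (N l 1 0) * (X : ℝ[X]) ^ e l = BN := by simp only [hBN, hsN]
  have hdet : Matrix.det ((∑ l, (X : ℝ[X]) ^ d l • (P l).map C) - ∑ l, (X : ℝ[X]) ^ e l • (N l).map C)
      = (AP * CP - BP * BP) + (AN * CN - BN * BN) - (AP * CN + CP * AN - 2 * (BP * BN)) := by
    rw [Matrix.det_fin_two, entry_eq₂, entry_eq₂, entry_eq₂, entry_eq₂, hBP', hBN',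
      ← hAP, ← hBP, ← hCP, ← hAN, ← hCN]
    ring
  rw [hdet, coeff_sub, coeff_add]
  -- the two pure parts are coefficient-nonnegative
  have h1 : 0 ≤ (AP * CP - BP * BP).coeff n := by
    rw [coeff_sub, hAP, hBP, hCP, coeff_sum_mul_sum₂, coeff_sum_mul_sum₂]
    exact double_sum_nonneg d _ _ _ (fun l => (psd2_data _ (hP l)).2.1)
      (fun l => (psd2_data _ (hP l)).2.2.1) (fun l => (psd2_data _ (hP l)).2.2.2) n
  have h2 : 0 ≤ (AN * CN - BN * BN).coeff n := by
    rw [coeff_sub, hAN, hBN, hCN, coeff_sum_mul_sum₂, coeff_sum_mul_sum₂]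
    exact double_sum_nonneg e _ _ _ (fun l => (psd2_data _ (hN l)).2.1)
      (fun l => (psd2_data _ (hN l)).2.2.1) (fun l => (psd2_data _ (hN l)).2.2.2) n
  -- the mixed part lives on the sumset d(I) + e(J)
  have hmix : ∀ (x y : Fin K → ℝ), (∀ l, l ∉ I → x l = 0) → (∀ l, l ∉ J → y l = 0) →
      ((∑ l, C (x l) * (X : ℝ[X]) ^ d l) * (∑ l, C (y l) * (X : ℝ[X]) ^ e l)).coeff n = 0 := by
    intro x y hx hy
    rw [coeff_sum_mul_sum₂]
    refine Finset.sum_eq_zero (fun l _ => Finset.sum_eq_zero (fun l' _ => ?_))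
    by_cases hl : l ∈ I
    · by_cases hl' : l' ∈ J
      · have : n ≠ d l + e l' := fun h => hn (Finset.mem_image₂.mpr ⟨l, hl, l', hl', h.symm⟩)
        rw [if_neg this]
      · rw [hy l' hl']; simp
    · rw [hx l hl]; simp
  have h3 : (AP * CN + CP * AN - 2 * (BP * BN)).coeff n = 0 := by
    have e1 : (AP * CN).coeff n = 0 := by
      rw [hAP, hCN]
      exact hmix (fun l => P l 0 0) (fun l => N l 1 1) (fun l hl => by simp [hI l hl])
        (fun l hl => by simp [hJ l hl])
    have e2 : (CP * AN).coeff n = 0 := by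
      rw [hCP, hAN]
      exact hmix (fun l => P l 1 1) (fun l => N l 0 0) (fun l hl => by simp [hI l hl])
        (fun l hl => by simp [hJ l hl])
    have e3 : (BP * BN).coeff n = 0 := by
      rw [hBP, hBN]
      exact hmix (fun l => P l 0 1) (fun l => N l 0 1) (fun l hl => by simp [hI l hl])
        (fun l hl => by simp [hJ l hl])
    rw [coeff_sub, coeff_add, e1, e2, two_mul, coeff_add, e3]
    simp
  linarith [h1, h2, h3]

theorem semidefinite_pair_two_le {K : ℕ} (d e : Fin K → ℕ) (P N : Fin K → Matrix (Fin 2) (Fin 2) ℝ)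
    (hP : ∀ l, (P l).PosSemidef) (hN : ∀ l, (N l).PosSemidef) (I J : Finset (Fin K))
    (hI : ∀ l, l ∉ I → P l = 0) (hJ : ∀ l, l ∉ J → N l = 0) :
    ((Matrix.det ((∑ l, (X : ℝ[X]) ^ d l • (P l).map C)
          - ∑ l, (X : ℝ[X]) ^ e l • (N l).map C)).roots.toFinset.filter (fun t => 0 < t)).card
      ≤ 2 * (I.card * J.card) := by
  set f := Matrix.det ((∑ l, (X : ℝ[X]) ^ d l • (P l).map C)
          - ∑ l, (X : ℝ[X]) ^ e l • (N l).map C) with hf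
  refine (card_posRoots_le_two_mul_negCoeffCount f).trans (Nat.mul_le_mul_left 2 ?_)
  have hsub : f.support.filter (fun n => f.coeff n < 0)
      ⊆ Finset.image₂ (fun l l' => d l + e l') I J := by
    intro n hn
    rw [Finset.mem_filter] at hn
    by_contra hno
    exact absurd (coeff_nonneg_off₂ d e P N hP hN I J hI hJ n hno) (not_le.mpr hn.2)
  exact (Finset.card_le_card hsub).trans (Finset.card_image₂_le _ _ _)

/-- **The semidefinite-word sector of the `(2,6)` door is closed: `Z₊ ≤ 18 ≤ 19`** (stmt-ValiantsHypothesis-19979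
`DoorA26 = PosRootLawAt 2 6 19`, same pencil expression).  Six `2×2` letters each PSD or NSD, ANY exponents
(repeats allowed), any heights, any interleaving of the sign word: `Z₊ ≤ 2·K_P·K_N ≤ 18`.  This is the class of
line `sign_split` (semidefinite words, V-currency) at `m = 2`, V-free; by the octave cell's definiteness census
(`Cruxes/WeakLifting/Lines/octave.md` (e)) no record pencil of the eleven-thirds register lies in it — every
`DoorA26` violator has an INDEFINITE letter (and, by `door26_rankOne_sector`, at least two negative squares). -/
theorem door26_semidefinite_sector (d : Fin 6 → ℕ) (S : Fin 6 → Matrix (Fin 2) (Fin 2) ℝ)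
    (hS : ∀ l, (S l).PosSemidef ∨ (-S l).PosSemidef) :
    ((Matrix.det (∑ l, (X : ℝ[X]) ^ d l • (S l).map C)).roots.toFinset.filter
      (fun t => 0 < t)).card ≤ 18 := by
  classical
  set I : Finset (Fin 6) := Finset.univ.filter (fun l => (S l).PosSemidef) with hIdef
  set J : Finset (Fin 6) := Finset.univ.filter (fun l => ¬ (S l).PosSemidef) with hJdef
  set P : Fin 6 → Matrix (Fin 2) (Fin 2) ℝ := fun l => if (S l).PosSemidef then S l else 0 with hPdef
  set N : Fin 6 → Matrix (Fin 2) (Fin 2) ℝ := fun l => if (S l).PosSemidef then 0 else -S l with hNdef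
  have hP : ∀ l, (P l).PosSemidef := fun l => by
    simp only [hPdef]; split_ifs with h
    · exact h
    · exact Matrix.PosSemidef.zero
  have hN : ∀ l, (N l).PosSemidef := fun l => by
    simp only [hNdef]; split_ifs with h
    · exact Matrix.PosSemidef.zero
    · exact (hS l).resolve_left h
  have hI : ∀ l, l ∉ I → P l = 0 := fun l hl => by
    have : ¬ (S l).PosSemidef := fun h => hl (by simp [hIdef, h])
    simp [hPdef, this]
  have hJ : ∀ l, l ∉ J → N l = 0 := fun l hl => by
    have : (S l).PosSemidef := by
      by_contra h; exact hl (by simp [hJdef, h])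
    simp [hNdef, this]
  have hsplit : (∑ l, (X : ℝ[X]) ^ d l • (S l).map C)
      = (∑ l, (X : ℝ[X]) ^ d l • (P l).map C) - ∑ l, (X : ℝ[X]) ^ d l • (N l).map C := by
    rw [← Finset.sum_sub_distrib]
    refine Finset.sum_congr rfl (fun l _ => ?_)
    have hSl : S l = P l - N l := by
      simp only [hPdef, hNdef]; split_ifs <;> simp
    rw [hSl, Matrix.map_sub _ (fun a b => (map_sub C a b)), smul_sub]
  rw [hsplit]
  refine (semidefinite_pair_two_le d d P N hP hN I J hI hJ).trans ?_
  have hcard : I.card + J.card = 6 := by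
    rw [hIdef, hJdef, Finset.card_filter_add_card_filter_not]; simp
  generalize I.card = a at hcard ⊢
  generalize J.card = b at hcard ⊢
  have ha : a ≤ 6 := by omega
  interval_cases a <;> omega

end Summit.ValiantsHypothesis.ValiantsHypothesis.Theorems.LacunarySymmetroidMatrixDescartes.NegSquaresRungs
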